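import Summits.BirchSwinnertonDyer.BirchSwinnertonDyer.Theses.KatoDescentTamePotSupersingular
import Summits.BirchSwinnertonDyer.Rank1Residual.X11b.KolyvaginBottomPoint
import Summits.BirchSwinnertonDyer.Rank1Residual.X11b.Three.KolyvaginLine
import Summits.BirchSwinnertonDyer.Rank1Residual.X11b.BDPRouteRankOneBookkeeping
import Literature.NumberTheory.EllipticCurves.HeegnerPointsOfConductorOneData
import Literature.NumberTheory.EllipticCurves.HeegnerPointsOfConductorOneRationalityProofs
import Literature.NumberTheory.EllipticCurves.HeegnerPointsOfConductorOneGaloisConjProofs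
import Literature.NumberTheory.EllipticCurves.HeegnerPointsKolyvaginPrimaryGeneratorProofs
import Literature.NumberTheory.EllipticCurves.BSDSelmerCMPConverseHeegnerFieldProofs
import Literature.NumberTheory.EllipticCurves.CuspFormLFunctionLevelConductorProofs
import HarnessLib
import Summits.BirchSwinnertonDyer.BirchSwinnertonDyer.Theses.KatoDescentPotSupersingular
import Summits.BirchSwinnertonDyer.BirchSwinnertonDyer.Theorems.KatoDescentTamePotSupersingularJetchevIrreducibleReadingOfStubs
import Summits.BirchSwinnertonDyer.BirchSwinnertonDyer.Theorems.KatoDescentPotSupersingularJetchevIrreducibleReadingOfStubs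
import Summits.BirchSwinnertonDyer.BirchSwinnertonDyer.Theorems.KatoDescentTamePotSupersingularJetchevIrreducibleReadingDivisibilityCoreVertexBridge
import Summits.BirchSwinnertonDyer.BirchSwinnertonDyer.Theorems.KatoDescentTamePotSupersingularJetchevIrreducibleReadingDivisibilityCoreVertexBridgePrimed
import Summits.BirchSwinnertonDyer.BirchSwinnertonDyer.Theorems.Rank1ResidualJetRingClassFields
import Summits.BirchSwinnertonDyer.BirchSwinnertonDyer.Theorems.KatoDescentTamePotSupersingularJetchevIrreducibleReadingThm52KernelInputsIrred
import Summits.BirchSwinnertonDyer.BirchSwinnertonDyer.Theorems.KatoDescentTamePotSupersingularJetchevIrreducibleReadingThm52KernelInputsCebotarev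

/-! **ARCHIVE** — skeleton v5 (plan g22, sha 781170fc0df6) ARCHIVED by plan g23 at the v6 adoption; namespace renamed `.BirthV5`; not registered, history only. -/

/-!
**v5 (planner bsd-potss-plan g22, 2026-08-27T10:3xZ).** v4 with the two McCallum/Jetchev READINGS PRIMED: `stub_prop52IrredP`
([McC] Prop. 5.2 read irreducible) and `stub_coreVertexExistenceIrredP` ([J] Prop. 5.3 read irreducible) now carry the row binder
`(p : ℤ) ∣ W.conductorNorm ℤ` right after `W.HasIrreducibleModPGaloisRep p` (every row of both faces is ADDITIVE at `p`, so the
composition feeds it from `Addv`; the unprimed v4 readings also quantified over good `p`, where no consumer needs them and where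
k8t-c4 g9's dihedral-corner analysis of h32I counsels caution). Bodies = the binders `h52I` / `hCVI` of k9-c4 g8's PRIMED BRIDGE
`JetchevIrreducibleReadingDivisibilityPrimed.divisibilityIrredAddv_of_prop52IrredP_of_coreVertexExistenceIrredP_of_thm63` (p521540)
VERBATIM, and byte-identical to the stubs of the same names in k9-c4 g8's candidate skeleton v2.1 of crux 19941 (one proof serves
both items). Other stubs (S1 `stub_structureIrred`, S5 `stub_prop44Irred`, S6 `stub_thm52KernelGapsAddv` (hardest), S7
`stub_publishedInputsHeegner`) byte-identical to v4 (registered sha 7582fe03aabf, superseded). Six `sorry`s, all in stubs.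
NEXT (v6, when k8t-c4 g10 lands the irreducible port of bsd-jet's H63 layers `…_of_localFacts_of_irreducible_of_heegner`): S6 re-cut to
bsd-jet's closed-statement list (C′, hdual_q, hdual_ℓ, 𝒯/hT, h49tr, h𝒮σ, Weil datum discharged).

# Crux `JetchevIrreducibleReadingByName` (item stmt-BirchSwinnertonDyer-20165, shared K8-t′ / K9) — skeleton v4
# (planner `bsd-potss-plan` g22, 2026-08-27; v3 = git history of this file @ 9eaa6f035676 / sha 256ec88ec5ba, v2 @ cfebba652cc8, v1 @ cb754136f12a)

WHY v4. `bsd-potss-k8t-c4` g9 showed that v3's stub `stub_cor32Irred` (= p508713's displayed reading `h32I`: McCallum Cor. 3.2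
with `onto` ↦ `E[p]` irreducible, NO Heegner hypothesis, NO `p ∣ N`) is FALSE as a ∀-statement — in the dihedral corner
`K ⊆ ℚ(E[p])` a `Γ_K`-endomorphism `A` with `τAτ⁻¹ = −A` turns every eigen-class `c` into an independent eigen-class `A_*c`
with identical local orders, so the prescribed-orders prime set is EMPTY (explicit instance: `y² = x³ − 6x + 8`, `p = 3`,
`K = ℚ(√−2)`, kit j273881; memo `pub/bsd-potss/k8t-c4/FINDING-20165-cebotarev-irreducible-k8t-c4-g9.md` §3) — and PROVED the
repaired reading `h32I′ := h32I + SatisfiesHeegnerHypothesis (W.conductorNorm ℤ) K + p ∣ W.conductorNorm ℤ` for all odd `p`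
(`JetchevIrreducibleCebotarev.cor32_localOrder_of_irreducible_of_heegner`, p516209, over p512847 / p514435 / p515261: Cor. 3.2 at
level `p^M` for ANY image with (Z)(S)(C), discharged over `K` from `ρ̄(Γ_K) = ρ̄(Γ_ℚ)` for `K` unramified at `p` and at the
bad primes), then re-issued g8's kernel theorem WITHOUT the binder `h32I`
(`JetchevIrreducibleReadingThm52.tamagawaExponent_le_mInfty_of_kernelInputs_of_irreducible_of_heegner`). v4 = v3 with `stub_cor32Irred` DROPPED
(a theorem is imported by name, never registered — planner rule g17 (v); the false display is recorded DEAD) and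
`H63IRowObjectsAddv_of h44 hKG` re-proved through the new theorem; SIX stubs, hardest unchanged `stub_thm52KernelGapsAddv`.
KNOWN RISK carried (g9 §3, to be removed in v5 together with a re-issued bridge `S2DivisibilityIrredAddv_of`): `stub_prop52IrredP` /
`stub_coreVertexExistenceIrredP` carry the Heegner hypothesis and `d_K ∉ {−3,−4}` but not `p ∣ N` (corner `K = ℚ(√−p)`).

WHY v3. `bsd-potss-k8t-c4` g8 CUT v2's hardest stub `stub_thm52RowObjectsAddv` ([J] Thm. 5.2 for the row objects at an
ADDITIVE `p`, `E[p]` IRREDUCIBLE) IN THE KERNEL: `JetchevIrreducibleReadingThm52.tamagawaExponent_le_mInfty_of_kernelInputs_of_irreducible`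
(p508713, over p507503 bricks / p507696 adapters / p508077 row form) = bsd-jet's H63 assembly with the `p`-adic tower
replaced by `hirr + p ∣ N`, needing per row (after g9) ONLY the READING `h44I` ([McC] Prop. 4.4, irreducible) plus bsd-jet's tower-case RESIDUAL (named print `hCM1`, `hCM2`, Gross Prop. 5.3
`h53`, [GZ86 III (3.1)] `hGZ`/`hcop′`; kernel gaps `htr`, `h49str`, `h49tr`, `hdual_q`, `hdual_ℓ` for SOME structures
`𝒯 𝒮 Qcar C′`). v3 makes exactly these the registered targets: v2's `Sig.stub_thm52RowObjectsAddv` becomes the PROVED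
node `Sig.H63IRowObjectsAddv` (`H63IRowObjectsAddv_of`, a real proof through g9's Čebotarev-free kernel theorem) over TWO
stubs, and the stub set is (6; each a genuine piece, none the crux reworded):

* `stub_structureIrred` (S1, v1-verbatim; MN19 Thm 0.7/§0.11 structure theorem, irreducible, no reduction binder —
  = Literature `MatarNekovar2019.thm07_…` p503175 in substance, published input, XL);
* `stub_prop52IrredP` (v2-verbatim; McCallum Prop. 5.2 read under irreducibility — READING);
* `stub_coreVertexExistenceIrredP` (v2-verbatim; Jetchev Prop. 5.3 = arXiv Prop. 6.4 read under irreducibility — READING);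
* (v3's `stub_cor32Irred` — DROPPED in v4: false as displayed, true + PROVED with the row binders, see WHY v4;)
* `stub_prop44Irred` (NEW = p508713's `h44I` verbatim: [McC] Prop. 4.4 — the local-condition comparison of the classes
  `P(mℓ)` vs `P(m)` at `λ ∣ ℓ` — irreducible reading);
* `stub_thm52KernelGapsAddv` (NEW, **hardest**: for the ROW OBJECTS of v2's H63I binders — additive `p`, `p ∤ c_p`,
  global Tamagawa binder, `q ∥ N`, `q ≠ p`, core vertex `c` at level `k > max(t, m_∞)`, `t = ord_p c_q` — the named
  print `hCM1 ∧ hCM2 ∧ ∃ε h53 ∧ ∃n′ hGZ` holds AND there EXIST Selmer structures `𝒯` (transverse at the primes of `c`),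
  `𝒮 ≤` Kummer, carrier places `Qcar` disjoint from `c`, `e′ = ε(−1)^r`, `C′ ≤` the `−e′` sign part, satisfying the
  five kernel gaps = Jetchev's Prop. 4.9 (stringent/transverse parts), Thm. 5.1 at the carrier with `#dual = p^t`, and
  Thm. 5.1/Lemma 5.2 (iii) at `λ` — i.e. bsd-jet register row D5's residual instantiated at an additive `p`);
* `stub_publishedInputsHeegner` (cite; the route's held conjunction `PublishedInputsHeegner`, item 19914).

`JetchevIrreducibleReadingByName_of` (K8-t′ decl) / `_of_K9` (K9 decl, shared signature) are REAL proofs from the six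
stubs (g8's capstones p502280 / p502729, the S2 cut p504157 / p504855, and g9's kernel theorem). `lean check`: sorries ONLY in
`stub_*` (6). HONEST FRAMING: conditional throughout; nothing booked; the crux, its stubs and BSD are as open as before.
Alternative lines on this crux: `Lines/alt_depthIndex_plan_g21.lean` (planner's depth-index cut); v2 / v3 in git history.
Source of the cut: bsd-potss-k8t-c4 g8 FINDING v3 §§5–6 and g9 FINDING (`pub/bsd-potss/k8t-c4/FINDING-20165-{irreducible-roadK-k8t-c4-g8,cebotarev-irreducible-k8t-c4-g9}.md`).

References: [cite: Jetchev2008, Cor. 1.5, Thm. 1.4, Prop. 4.4, Prop. 4.9, Lemma 5.1, Thm. 5.1, Prop. 5.3, Thm. 5.2 (p. 821), Rem. 6.2]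
[cite: MatarNekovar2019, Thm. 0.7, §0.11] [cite: McCallumLMS1991, §3 Cor. 3.2, §4 Prop. 4.4, Prop. 5.2, Cor. 5.6]
[cite: GrossLMS1991, §3, Prop. 5.3, Prop. 5.4, Prop. 6.2 (1)] [cite: GrossZagier1986, III (3.1)] [cite: Cox2013, §9.A]
-/


set_option linter.dupNamespace false
set_option autoImplicit false

noncomputable section

open scoped Classical

open WeierstrassCurve IsDedekindDomain NumberField Literature.NumberTheory.EllipticCurves
open Literature.NumberTheory.EllipticCurves.Jetchev2008
open Literature.NumberTheory.GaloisRepresentations Literature.NumberTheory.GaloisRepresentations.DiscreteGaloisModule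
open Summit.BirchSwinnertonDyer.Rank1Residual.JET
open Literature.NumberTheory.EllipticCurves.ModularForms
open Literature.NumberTheory.EllipticCurves.Rank1Residual
open Summit.BirchSwinnertonDyer.Rank1Residual Summit.BirchSwinnertonDyer.Rank1Residual.X11b
open Summit.BirchSwinnertonDyer.BirchSwinnertonDyer.Theses.KatoDescentTamePotSupersingular
open Summit.BirchSwinnertonDyer.BirchSwinnertonDyer.Theorems
open Summit.BirchSwinnertonDyer.BirchSwinnertonDyer.Theorems.JetchevIrreducibleReadingDivisibility

namespace Summit.BirchSwinnertonDyer.BirchSwinnertonDyer.Cruxes.JetchevIrreducibleReadingByName.BirthV5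

/-- Statement of `stub_structureIrred` (S1): Kolyvagin's structure theorem, UPPER half, under IRREDUCIBILITY of
`E[p]`, with NO reduction-type binder at `p` (McCallum currency): `ord_p #Ш(E/K)[p^∞] + 2t ≤ 2M₀`
(`p^{M₀} ∥ y_K` in `E(K)`) when every derived Heegner point is `p^s`-divisible at every depth `s ≤ t`.
= `Cha2005.rmk25_padicValNat_card_sha_primary_add_le_of_globalDivisibility` minus `p ∤ d_K`, `p² ∤ N`
(Matar–Nekovář 2019 Thm. 0.7 + §0.11; McCallum 1991 Cor. 5.6). -/
abbrev Sig.stub_structureIrred : Prop :=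
  ∀ (W : WeierstrassCurve ℚ) [W.IsElliptic] [W.IsGloballyMinimal] [NeZero (W.conductorNorm ℤ)],
    ¬ W.HasCM →
    ∀ (K : Type) [Field K] [NumberField K], IsImaginaryQuadratic K →
    NumberField.discr K ≠ -3 → NumberField.discr K ≠ -4 →
    SatisfiesHeegnerHypothesis (W.conductorNorm ℤ) K →
    ∀ (p : ℕ) [Fact p.Prime], p ≠ 2 → W.HasIrreducibleModPGaloisRep p →
    ∀ (Dt : ModularParametrizationData W (W.conductorNorm ℤ)) (β : ℤ) (ι : K →+* ℂ)
      (d₁ : KolyvaginHeegnerData Dt β ι 1) (P : (W.baseChange K).toAffine.Point),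
      d₁.toGeomPoints d₁.derivedPoint = toGeomPoints (W.baseChange K) P →
      ¬ IsOfFinAddOrder P →
    ∀ (M₀ : ℕ),
      (∃ Q : (W.baseChange K).toAffine.Point, ((p ^ M₀ : ℕ) : ℤ) • Q = P) →
      (¬ ∃ Q : (W.baseChange K).toAffine.Point, ((p ^ (M₀ + 1) : ℕ) : ℤ) • Q = P) →
    ∀ (t : ℕ),
      (∀ (s : ℕ), s ≤ t → ∀ (n : ℕ) (d : KolyvaginHeegnerData Dt β ι n), Squarefree n →
        (∀ ℓ ∈ n.primeFactors, Zhang2014.IsKolyvaginPrime (W.conductorNorm ℤ) W K p ℓ ∧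
          s ≤ Zhang2014.kolyvaginIndex W p ℓ) →
        ∃ Q : (W.baseChange (ringClassField K ι n)).toAffine.Point,
          ((p ^ s : ℕ) : ℤ) • Q = d.derivedPoint) →
    padicValNat p (Nat.card (AddCommGroup.primaryComponent (W.baseChange K).sha p)) + 2 * t ≤ 2 * M₀

abbrev Sig.S2DivisibilityIrredAddv : Prop :=
  ∀ (W : WeierstrassCurve ℚ) [W.IsElliptic] [W.IsGloballyMinimal] [NeZero (W.conductorNorm ℤ)],
    ¬ W.HasCM →
    ∀ (K : Type) [Field K] [NumberField K], IsImaginaryQuadratic K →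
    NumberField.discr K ≠ -3 → NumberField.discr K ≠ -4 →
    SatisfiesHeegnerHypothesis (W.conductorNorm ℤ) K →
    ∀ (p : ℕ) [Fact p.Prime], p ≠ 2 → Addv W p → 0 ≤ padicValRat p W.j →
    W.HasIrreducibleModPGaloisRep p →
    ¬ p ∣ (W.baseChange ℚ_[p]).localTamagawaNumber ℤ_[p] →
    (∀ (q' : ℕ) [Fact q'.Prime], q' ∣ W.conductorNorm ℤ →
      p ∣ (W.baseChange ℚ_[q']).localTamagawaNumber ℤ_[q'] → ¬ q' ^ 2 ∣ W.conductorNorm ℤ) →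
    ∀ (Dt : ModularParametrizationData W (W.conductorNorm ℤ)) (β : ℤ) (ι : K →+* ℂ)
      (d₁ : KolyvaginHeegnerData Dt β ι 1), ¬ IsOfFinAddOrder d₁.derivedPoint →
    ∀ (q : ℕ) [Fact q.Prime], q ∣ W.conductorNorm ℤ → ¬ q ^ 2 ∣ W.conductorNorm ℤ → q ≠ p →
    ∀ (s : ℕ), s ≤ padicValNat p ((W.baseChange ℚ_[q]).localTamagawaNumber ℤ_[q]) →
    ∀ (n : ℕ) (d : KolyvaginHeegnerData Dt β ι n), Squarefree n →
      (∀ ℓ ∈ n.primeFactors, Zhang2014.IsKolyvaginPrime (W.conductorNorm ℤ) W K p ℓ ∧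
        s ≤ Zhang2014.kolyvaginIndex W p ℓ) →
      ∃ Q : (W.baseChange (ringClassField K ι n)).toAffine.Point,
        ((p ^ s : ℕ) : ℤ) • Q = d.derivedPoint

/-- Statement of `stub_prop52IrredP`: McCallum 1991 Prop. 5.2 («`M_r < M ⟹ ∃ c ∈ Λ^r_M` with `ord P(c)` of exact order `p^{M−M_r}`») in the IRREDUCIBLE reading — the `p`-adic-tower / surjectivity binder replaced by `W.HasIrreducibleModPGaloisRep p` (valid under absolute irreducibility by Jetchev 2008 Rem. 6.2: the proof uses the image only through the Čebotarev Cor. 3.2). VERBATIM the hypothesis `h52I` of `divisibilityIrredAddv_of_prop52Irred_of_coreVertexExistenceIrred_of_thm63` (p504855). A READING, displayed, nothing asserted. [cite: McCallumLMS1991, §5 Prop. 5.2 (p. 304), §3 Cor. 3.2] [cite: Jetchev2008, Rem. 6.2] — v5: PRIMED reading (+ `(p : ℤ) ∣ W.conductorNorm ℤ` after irreducibility; fed from `Addv` in the composition), body = binder `h52I` of k9-c4 g8's primed bridge p521540 verbatim. -/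
abbrev Sig.stub_prop52IrredP : Prop :=
  ∀ (W : WeierstrassCurve ℚ) [W.IsElliptic] [W.IsGloballyMinimal] [NeZero (W.conductorNorm ℤ)],
      ¬ W.HasCM →
      ∀ (K : Type) [Field K] [NumberField K], IsImaginaryQuadratic K →
      NumberField.discr K ≠ -3 → NumberField.discr K ≠ -4 →
      SatisfiesHeegnerHypothesis (W.conductorNorm ℤ) K →
      ∀ (p : ℕ) [Fact p.Prime], p ≠ 2 → W.HasIrreducibleModPGaloisRep p → (p : ℤ) ∣ W.conductorNorm ℤ →
      ∀ (Dt : ModularParametrizationData W (W.conductorNorm ℤ)) (β : ℤ) (ι : K →+* ℂ)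
        (d₁ : KolyvaginHeegnerData Dt β ι 1), ¬ IsOfFinAddOrder d₁.derivedPoint →
      ∀ (r : ℕ), 0 < r →
      ∀ (Mr : ℕ),
        IsLeast {u : ℕ | ∃ (n : ℕ) (d : KolyvaginHeegnerData Dt β ι n), Squarefree n ∧
            n.primeFactors.card = r ∧
            (∀ ℓ ∈ n.primeFactors, Zhang2014.IsKolyvaginPrime (W.conductorNorm ℤ) W K p ℓ ∧
              u + 1 ≤ Zhang2014.kolyvaginIndex W p ℓ) ∧
            (∃ Q : (W.baseChange (ringClassField K ι n)).toAffine.Point,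
              ((p ^ u : ℕ) : ℤ) • Q = d.derivedPoint) ∧
            ¬ ∃ Q : (W.baseChange (ringClassField K ι n)).toAffine.Point,
              ((p ^ (u + 1) : ℕ) : ℤ) • Q = d.derivedPoint} Mr →
      ∀ (M : ℕ), Mr < M →
        ∃ (n : ℕ) (d : KolyvaginHeegnerData Dt β ι n), Squarefree n ∧ n.primeFactors.card = r ∧
          (∀ ℓ ∈ n.primeFactors, Zhang2014.IsKolyvaginPrime (W.conductorNorm ℤ) W K p ℓ ∧
            M ≤ Zhang2014.kolyvaginIndex W p ℓ) ∧
          addOrderOf (d.kolyvaginClass (Fact.out : p.Prime) M) = p ^ (M - Mr) ∧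
          (∃ Q : (W.baseChange (ringClassField K ι n)).toAffine.Point,
            ((p ^ Mr : ℕ) : ℤ) • Q = d.derivedPoint) ∧
          ¬ ∃ Q : (W.baseChange (ringClassField K ι n)).toAffine.Point,
            ((p ^ (Mr + 1) : ℕ) : ℤ) • Q = d.derivedPoint

/-- Statement of `stub_coreVertexExistenceIrredP`: Jetchev 2008 Prop. 5.3 (= arXiv:math/0703431 Prop. 6.4: a core vertex of every level `m ≥ 1` above a conductor with non-torsion, exactly-`p^s`-divisible derived point and `s + m ≤ M(c)`) in the IRREDUCIBLE reading — bsd-jet's reading binder `JET.JetchevCoreVertexExistence` with its tower binder replaced by `W.HasIrreducibleModPGaloisRep p`. VERBATIM the hypothesis `hCVI` of p504855. A READING, displayed, nothing asserted. [cite: Jetchev2008, Prop. 5.3 (p. 823), Lemma 5.1, Rem. 6.2] — v5: PRIMED reading (+ `(p : ℤ) ∣ W.conductorNorm ℤ`), body = binder `hCVI` of p521540 verbatim. -/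
abbrev Sig.stub_coreVertexExistenceIrredP : Prop :=
  ∀ (W : WeierstrassCurve ℚ) [W.IsElliptic] [W.IsGloballyMinimal] [NeZero (W.conductorNorm ℤ)],
      ¬ W.HasCM →
      ∀ (K : Type) [Field K] [NumberField K], IsImaginaryQuadratic K →
      NumberField.discr K ≠ -3 → NumberField.discr K ≠ -4 →
      SatisfiesHeegnerHypothesis (W.conductorNorm ℤ) K →
      ∀ (τ : K ≃ₐ[ℚ] K), τ ≠ 1 →
      ∀ (p : ℕ) [Fact p.Prime], p ≠ 2 → W.HasIrreducibleModPGaloisRep p → (p : ℤ) ∣ W.conductorNorm ℤ →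
      ∀ (Dt : ModularParametrizationData W (W.conductorNorm ℤ)) (β : ℤ) (ι : K →+* ℂ)
        [∀ k : ℕ, NumberField (ringClassField K ι k)]
        (d₁ : KolyvaginHeegnerData Dt β ι 1), ¬ IsOfFinAddOrder d₁.derivedPoint →
      ∀ (m : ℕ), 1 ≤ m →
      ∀ (c : ℕ) (d : KolyvaginHeegnerData Dt β ι c), Squarefree c →
        (∀ ℓ ∈ c.primeFactors, Zhang2014.IsKolyvaginPrime (W.conductorNorm ℤ) W K p ℓ) →
      ∀ (s : ℕ), ¬ IsOfFinAddOrder d.derivedPoint →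
        (∃ Q : (W.baseChange (ringClassField K ι c)).toAffine.Point,
          ((p ^ s : ℕ) : ℤ) • Q = d.derivedPoint) →
        (¬ ∃ Q : (W.baseChange (ringClassField K ι c)).toAffine.Point,
          ((p ^ (s + 1) : ℕ) : ℤ) • Q = d.derivedPoint) →
        ((s + m : ℕ) : ℕ∞) ≤ Zhang2014.levelIndex W p c →
        ∃ (c' : ℕ) (d' : KolyvaginHeegnerData Dt β ι c'), Squarefree c' ∧
          (∀ ℓ ∈ c'.primeFactors, Zhang2014.IsKolyvaginPrime (W.conductorNorm ℤ) W K p ℓ ∧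
            m + s ≤ Zhang2014.kolyvaginIndex W p ℓ) ∧
          Jetchev2008.IsGlobalCoreVertex W K ι τ p m c' ∧
          ¬ IsOfFinAddOrder d'.derivedPoint ∧
          ¬ ∃ Q : (W.baseChange (ringClassField K ι c')).toAffine.Point,
            ((p ^ (s + 1) : ℕ) : ℤ) • Q = d'.derivedPoint

/-- v2's `Sig.stub_thm52RowObjectsAddv`, NO LONGER A STUB since v3 (v4: proved from `stub_prop44Irred`,
`stub_thm52KernelGapsAddv` by `H63IRowObjectsAddv_of` through g9's Čebotarev-free kernel theorem): [J] Thm. 5.2 (= arXiv Thm. 6.3, the core-vertex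
kernel bound `ord_p c_q ≤ m_∞`) INSTANTIATED for the row objects under the additive-`p` binders. Body byte-identical to
v2's stub. [cite: Jetchev2008, Thm. 5.2 (p. 821)] -/
abbrev Sig.H63IRowObjectsAddv : Prop :=
   ∀ (W : WeierstrassCurve ℚ) [W.IsElliptic] [W.IsGloballyMinimal] [NeZero (W.conductorNorm ℤ)],
    ¬ W.HasCM → ∀ (K : Type) [Field K] [NumberField K], IsImaginaryQuadratic K →
    NumberField.discr K ≠ -3 → NumberField.discr K ≠ -4 →
    SatisfiesHeegnerHypothesis (W.conductorNorm ℤ) K →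
    ∀ (τ : K ≃ₐ[ℚ] K), τ ≠ 1 →
    ∀ (p : ℕ) [Fact p.Prime], p ≠ 2 → Rank1Residual.Addv W p → 0 ≤ padicValRat p W.j →
    W.HasIrreducibleModPGaloisRep p →
    ¬ p ∣ (W.baseChange ℚ_[p]).localTamagawaNumber ℤ_[p] →
    (∀ (q' : ℕ) [Fact q'.Prime], q' ∣ W.conductorNorm ℤ →
      p ∣ (W.baseChange ℚ_[q']).localTamagawaNumber ℤ_[q'] → ¬ q' ^ 2 ∣ W.conductorNorm ℤ) →
    ∀ (Dt : ModularParametrizationData W (W.conductorNorm ℤ)) (β : ℤ) (ι : K →+* ℂ)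
      [∀ k : ℕ, NumberField (ringClassField K ι k)]
      (d₁ : KolyvaginHeegnerData Dt β ι 1), ¬ IsOfFinAddOrder d₁.derivedPoint →
    ∀ (q : ℕ) [Fact q.Prime], q ∣ W.conductorNorm ℤ → ¬ q ^ 2 ∣ W.conductorNorm ℤ → q ≠ p →
    ∀ (mdiv m : {c : ℕ // Squarefree c ∧ ∀ ℓ ∈ c.primeFactors,
        Zhang2014.IsKolyvaginPrime (W.conductorNorm ℤ) W K p ℓ} → ℕ∞),
    (∀ c (u : ℕ), (u : ℕ∞) ≤ mdiv c ↔ ∀ d : KolyvaginHeegnerData Dt β ι c.1,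
      ∃ Q : (W.baseChange (ringClassField K ι c.1)).toAffine.Point,
        ((p ^ u : ℕ) : ℤ) • Q = d.derivedPoint) →
    (∀ c, m c = if mdiv c < Zhang2014.levelIndex W p c.1 then mdiv c else ⊤) →
    ∀ mInf : ℕ, (∀ c, (mInf : ℕ∞) ≤ m c) →
      (∀ m' : ℕ, ∃ c, (m' : ℕ∞) ≤ Zhang2014.levelIndex W p c.1 ∧ m c = mInf) →
    ∀ (k : ℕ) c, 1 ≤ k → Jetchev2008.IsGlobalCoreVertex W K ι τ p k c.1 → m c = mInf →
      (k : ℕ∞) + mInf ≤ Zhang2014.levelIndex W p c.1 →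
      padicValNat p ((W.baseChange ℚ_[q]).localTamagawaNumber ℤ_[q]) < k → mInf < k →
      padicValNat p ((W.baseChange ℚ_[q]).localTamagawaNumber ℤ_[q]) ≤ mInf

/-- Statement of `stub_prop44Irred` (NEW in v3; = the hypothesis `h44I` of p508713 VERBATIM): McCallum 1991 Prop. 4.4
— at a place `λ ∣ ℓ` of `K`, for compatible Kolyvagin–Heegner data of conductors `m` and `mℓ` (all prime factors
Kolyvagin of index `≥ M`), the `p^j`-multiples of the Kolyvagin class at `mℓ` lie in the Selmer local condition at `λ`
iff in the torsion local kernel, iff the same holds for the class at `m` — read with `E[p]` irreducible in place of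
surjectivity. WHY IT MIGHT FAIL: expected to be an image-free port of McCallum §4, but the additive place `p ∣ N` and
the ring-class-field ramification at `ℓ` have not been checked in this reading by anyone.
[cite: McCallumLMS1991, §4 Prop. 4.4] [cite: Jetchev2008, Prop. 4.4, Rem. 6.2] -/
abbrev Sig.stub_prop44Irred : Prop :=
  ∀ (W : WeierstrassCurve ℚ) [W.IsElliptic] [W.IsGloballyMinimal] [NeZero (W.conductorNorm ℤ)],
        ¬ W.HasCM →
        ∀ (K : Type) [Field K] [NumberField K], IsImaginaryQuadratic K →
        NumberField.discr K ≠ -3 → NumberField.discr K ≠ -4 →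
        SatisfiesHeegnerHypothesis (W.conductorNorm ℤ) K →
        ∀ (p : ℕ) [Fact p.Prime], p ≠ 2 → W.HasIrreducibleModPGaloisRep p →
        ∀ (Dt : ModularParametrizationData W (W.conductorNorm ℤ)) (β : ℤ) (ι : K →+* ℂ)
          (M : ℕ), 1 ≤ M →
        ∀ (m l : ℕ), Squarefree (m * l) → l.Prime → ¬ l ∣ m →
          (∀ l' ∈ (m * l).primeFactors, Zhang2014.IsKolyvaginPrime (W.conductorNorm ℤ) W K p l' ∧
            M ≤ Zhang2014.kolyvaginIndex W p l') →
        ∀ (d : KolyvaginHeegnerData Dt β ι m) (d' : KolyvaginHeegnerData Dt β ι (m * l)),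
          (∀ l' ∈ m.primeFactors, ∀ (x : ringClassField K ι m) (x' : ringClassField K ι (m * l)),
            (x : ℂ) = x' → ((d'.σ l' x' : ringClassField K ι (m * l)) : ℂ) = (d.σ l' x : ℂ)) →
          (∀ s ∈ d.S, ∃ s' ∈ d'.S, ∀ (x : ringClassField K ι m) (x' : ringClassField K ι (m * l)),
            (x : ℂ) = x' → ((s' x' : ringClassField K ι (m * l)) : ℂ) = (s x : ℂ)) →
          (∀ s' ∈ d'.S, ∃ s ∈ d.S, ∀ (x : ringClassField K ι m) (x' : ringClassField K ι (m * l)),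
            (x : ℂ) = x' → ((s' x' : ringClassField K ι (m * l)) : ℂ) = (s x : ℂ)) →
          (∀ (x : ringClassField K ι m) (x' : ringClassField K ι (m * l)),
            (x : ℂ) = x' → d'.emb x' = d.emb x) →
        ∀ (v : HeightOneSpectrum (𝓞 K)), (l : 𝓞 K) ∈ v.asIdeal →
        ∀ (j : ℕ),
          (((p ^ j : ℕ) : ℤ) • d'.kolyvaginClass (Fact.out : p.Prime) M ∈
              selmerLocalKer (W.baseChange K) (v.adicCompletion K) ((p ^ M : ℕ) : ℤ) ↔
            ((p ^ j : ℕ) : ℤ) • d'.kolyvaginClass (Fact.out : p.Prime) M ∈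
              (W.baseChange K).torsionLocalKer (v.adicCompletion K) ((p ^ M : ℕ) : ℤ)) ∧
          (((p ^ j : ℕ) : ℤ) • d'.kolyvaginClass (Fact.out : p.Prime) M ∈
              (W.baseChange K).torsionLocalKer (v.adicCompletion K) ((p ^ M : ℕ) : ℤ) ↔
            ((p ^ j : ℕ) : ℤ) • d.kolyvaginClass (Fact.out : p.Prime) M ∈
              (W.baseChange K).torsionLocalKer (v.adicCompletion K) ((p ^ M : ℕ) : ℤ))

/-- Statement of `stub_thm52KernelGapsAddv` (NEW in v3, **hardest**): for the ROW OBJECTS of `Sig.H63IRowObjectsAddv`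
(identical binders: non-CM `W`, Heegner field `K` with `d_K ∉ {−3,−4}`, `τ ≠ 1`, odd additive potentially good `p`
with `E[p]` irreducible, `p ∤ c_p`, the global Tamagawa binder, a non-torsion basic Heegner point, the carrier `q ∥ N`,
`q ≠ p`, the divisibility-index functions `mdiv`/`m` with minimum `m_∞` attained cofinally, a core vertex `c` at level
`k > max(ord_p c_q, m_∞)` with `k + m_∞ ≤ M(c)`), the INPUTS of the kernel theorem beyond `h44I` hold: the named print
`hCM1` (Gross §3: `φ(x₁) ∈ E(K₁)`), `hCM2` (a generator of `Gal(K_c/K₁)` over `K`), Gross Prop. 5.3 for a Fricke sign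
`ε` (`h53`), [GZ86 III (3.1)] in the receptacle form with an `n′` prime to `p` (`hGZ`), AND THERE EXIST Selmer
structures `𝒯` (cutting out exactly the transverse classes at the primes of `c`), `𝒮 ≤` Kummer, carrier places `Qcar`
disjoint from `c`, `e′ = ε(−1)^(#primes of c)`, `C′ ≤` the `(−e′)`-sign part, with the five KERNEL GAPS of bsd-jet's
register row D5: `htr` (the classes at `c` are transverse at the primes of `c`), `hdual_q` (Thm. 5.1 at the carrier:
complementary ranges of the two localisation maps in a cyclic module of order `p^(ord_p c_q)`), `h49str` / `h49tr`
(Prop. 4.9: stringent part at `Qcar`, transverse part at the primes of `c`, for the classes at `cℓ`), `hdual_ℓ`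
(Thm. 5.1 / Lemma 5.2 (iii) at `λ ∣ ℓ`). WHY IT MIGHT FAIL: the stringent local condition at `v ∣ p` for an ADDITIVE
potentially supersingular `p` is the x11b3 layer theorem only under `p ∤ c_p` plus a uniformizer hypothesis unverified in
this regime, and `#dual = p^(ord_p c_q)` presumes the carrier's component group is the whole local defect at `q`
(true for `q ∥ N`, `q ≠ p` by Tate duality — to be matched against the tree's `localTamagawaNumber`); these are ALSO
bsd-jet's open tower-case gaps (register row D5). Sources: Jetchev 2008 §§4–5; bsd-jet `Rank1ResidualJetThm63KernelInputs.lean`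
(p501299) and register row D5; bsd-potss-k8t-c4 g8 FINDING v3 §6.
[cite: Jetchev2008, Prop. 4.9, Thm. 5.1, Lemma 5.2, Thm. 5.2 (p. 821)] [cite: GrossLMS1991, §3, Prop. 5.3]
[cite: GrossZagier1986, III (3.1)] -/
abbrev Sig.stub_thm52KernelGapsAddv : Prop :=
   ∀ (W : WeierstrassCurve ℚ) [W.IsElliptic] [W.IsGloballyMinimal] [NeZero (W.conductorNorm ℤ)],
    ¬ W.HasCM → ∀ (K : Type) [Field K] [NumberField K], IsImaginaryQuadratic K →
    NumberField.discr K ≠ -3 → NumberField.discr K ≠ -4 →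
    SatisfiesHeegnerHypothesis (W.conductorNorm ℤ) K →
    ∀ (τ : K ≃ₐ[ℚ] K), τ ≠ 1 →
    ∀ (p : ℕ) [Fact p.Prime], p ≠ 2 → Rank1Residual.Addv W p → 0 ≤ padicValRat p W.j →
    W.HasIrreducibleModPGaloisRep p →
    ¬ p ∣ (W.baseChange ℚ_[p]).localTamagawaNumber ℤ_[p] →
    (∀ (q' : ℕ) [Fact q'.Prime], q' ∣ W.conductorNorm ℤ →
      p ∣ (W.baseChange ℚ_[q']).localTamagawaNumber ℤ_[q'] → ¬ q' ^ 2 ∣ W.conductorNorm ℤ) →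
    ∀ (Dt : ModularParametrizationData W (W.conductorNorm ℤ)) (β : ℤ) (ι : K →+* ℂ)
      [∀ k : ℕ, NumberField (ringClassField K ι k)]
      (d₁ : KolyvaginHeegnerData Dt β ι 1), ¬ IsOfFinAddOrder d₁.derivedPoint →
    ∀ (q : ℕ) [Fact q.Prime], q ∣ W.conductorNorm ℤ → ¬ q ^ 2 ∣ W.conductorNorm ℤ → q ≠ p →
    ∀ (mdiv m : {c : ℕ // Squarefree c ∧ ∀ ℓ ∈ c.primeFactors,
        Zhang2014.IsKolyvaginPrime (W.conductorNorm ℤ) W K p ℓ} → ℕ∞),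
    (∀ c (u : ℕ), (u : ℕ∞) ≤ mdiv c ↔ ∀ d : KolyvaginHeegnerData Dt β ι c.1,
      ∃ Q : (W.baseChange (ringClassField K ι c.1)).toAffine.Point,
        ((p ^ u : ℕ) : ℤ) • Q = d.derivedPoint) →
    (∀ c, m c = if mdiv c < Zhang2014.levelIndex W p c.1 then mdiv c else ⊤) →
    ∀ mInf : ℕ, (∀ c, (mInf : ℕ∞) ≤ m c) →
      (∀ m' : ℕ, ∃ c, (m' : ℕ∞) ≤ Zhang2014.levelIndex W p c.1 ∧ m c = mInf) →
    ∀ (k : ℕ) c, 1 ≤ k → Jetchev2008.IsGlobalCoreVertex W K ι τ p k c.1 → m c = mInf →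
      (k : ℕ∞) + mInf ≤ Zhang2014.levelIndex W p c.1 →
      padicValNat p ((W.baseChange ℚ_[q]).localTamagawaNumber ℤ_[q]) < k → mInf < k →
      (phi_heegnerPointOfConductor_mem_range_map_ringClassField (W.conductorNorm ℤ) W K ∧
      exists_generator_ringClassGalOver K ∧
      ∃ (ε : ℤ), (ε = 1 ∨ ε = -1) ∧
        (∀ (m : ℕ) (dm : KolyvaginHeegnerData Dt β ι m)
          (τm : ringClassField K ι m ≃ₐ[ℚ] ringClassField K ι m),
          (∀ x : ringClassField K ι m, ((τm x : ringClassField K ι m) : ℂ) = starRingEnd ℂ x) →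
          ∃ σ' ∈ ringClassGal ι m, IsOfFinAddOrder
          (pointGalHom W (ringClassField K ι m) τm dm.y -
          ε • pointGalHom W (ringClassField K ι m) σ' dm.y)) ∧
        ∃ (n' : ℤ), IsCoprime (p : ℤ) n' ∧
        (∀ (m : ℕ) (dm : KolyvaginHeegnerData Dt β ι m)
          (γ : ringClassField K ι m ≃ₐ[ℚ] ringClassField K ι m), γ ∈ ringClassGal ι m →
          ∀ v : HeightOneSpectrum (𝓞 K), ¬ (W.baseChange K).HasGoodReductionAt v →
          n' • pointsMap (W.baseChange K) (v.adicCompletion K)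
          (dm.toGeomPoints (pointGalHom W (ringClassField K ι m) γ dm.y)) ∈
          E0Receptacle (W.baseChange K) v ∧
          ∀ (ℓ : ℕ), ℓ ∈ m.primeFactors → ∀ (dm' : KolyvaginHeegnerData Dt β ι (m / ℓ))
          (hle : ringClassField K ι (m / ℓ) ≤ ringClassField K ι m),
          n' • pointsMap (W.baseChange K) (v.adicCompletion K)
          (dm.toGeomPoints (pointGalHom W (ringClassField K ι m) γ
          (WeierstrassCurve.Affine.Point.map (W' := W)
          ((RingClassField.inclusion ι hle).restrictScalars ℚ) dm'.y))) ∈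
          E0Receptacle (W.baseChange K) v) ∧
        ∃ (𝒯 𝒮 : SelmerStructure ((W.baseChange K).torsionGaloisModule ((p ^ k : ℕ) : ℤ)))
          (Qcar : Finset (HeightOneSpectrum (𝓞 K))) (e' : ℤ)
          (C' : AddSubgroup (galH1Torsion (W.baseChange K) ((p ^ k : ℕ) : ℤ))),
          (∀ x : galoisCohomology ((W.baseChange K).torsionGaloisModule ((p ^ k : ℕ) : ℤ)) 1,
            (∀ w ∈ placesDividing K c.1,
            galoisCohomology.localization ((W.baseChange K).torsionGaloisModule ((p ^ k : ℕ) : ℤ))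
            (Sum.inr w) 1 x ∈ 𝒯 (Sum.inr w)) ↔
            ∀ ℓ ∈ c.1.primeFactors, x ∈ transverseKer W K ι ((p ^ k : ℕ) : ℤ) ℓ) ∧
          (∀ v, 𝒮 v ≤ (W.baseChange K).kummerSelmerStructure ((p ^ k : ℕ) : ℤ) v) ∧
          Disjoint Qcar (placesDividing K c.1) ∧
          e' = ε * (-1) ^ c.1.primeFactors.card ∧
          C' ≤ signPart W K τ ((p ^ k : ℕ) : ℤ) (-e') ⊤ ∧
          (∀ (d : KolyvaginHeegnerData Dt β ι c.1), ∀ ℓ ∈ c.1.primeFactors,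
            (d.kolyvaginClass (Fact.out : p.Prime) k :
            galoisCohomology ((W.baseChange K).torsionGaloisModule ((p ^ k : ℕ) : ℤ)) 1) ∈
            transverseKer W K ι ((p ^ k : ℕ) : ℤ) ℓ) ∧
          (∃ (Qg Qg' : Type) (_ : AddCommGroup Qg) (_ : AddCommGroup Qg') (_ : Finite Qg')
            (locq : signPart W K τ ((p ^ k : ℕ) : ℤ) (-e')
            (modifiedSelmerGroup W K ι ((p ^ k : ℕ) : ℤ) c.1) →+ Qg)
            (locq' : C' →+ Qg'),
            (∀ x : C', locq' x = 0 ↔ (x : galH1Torsion (W.baseChange K) ((p ^ k : ℕ) : ℤ)) ∈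
            signPart W K τ ((p ^ k : ℕ) : ℤ) (-e') (modifiedSelmerGroup W K ι ((p ^ k : ℕ) : ℤ) c.1)) ∧
            Nat.card locq.range * Nat.card locq'.range = Nat.card Qg' ∧ IsAddCyclic Qg' ∧ Nat.card Qg' = p ^ padicValNat p ((W.baseChange ℚ_[q]).localTamagawaNumber ℤ_[q])) ∧
          (∀ (ℓ : ℕ), Zhang2014.IsKolyvaginPrime (W.conductorNorm ℤ) W K p ℓ →
            k ≤ Zhang2014.kolyvaginIndex W p ℓ → ℓ ∉ c.1.primeFactors →
            ∀ (d' : KolyvaginHeegnerData Dt β ι (c.1 * ℓ)), ∀ q ∈ Qcar,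
            galoisCohomology.localization ((W.baseChange K).torsionGaloisModule ((p ^ k : ℕ) : ℤ))
            (Sum.inr q) 1 (d'.kolyvaginClass (Fact.out : p.Prime) k) ∈ 𝒮 (Sum.inr q)) ∧
          (∀ (ℓ : ℕ), Zhang2014.IsKolyvaginPrime (W.conductorNorm ℤ) W K p ℓ →
            k ≤ Zhang2014.kolyvaginIndex W p ℓ → ℓ ∉ c.1.primeFactors →
            ∀ (d' : KolyvaginHeegnerData Dt β ι (c.1 * ℓ)), ∀ w ∈ placesDividing K c.1,
            galoisCohomology.localization ((W.baseChange K).torsionGaloisModule ((p ^ k : ℕ) : ℤ))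
            (Sum.inr w) 1 (d'.kolyvaginClass (Fact.out : p.Prime) k) ∈ 𝒯 (Sum.inr w)) ∧
          (∀ (ℓ : ℕ), Zhang2014.IsKolyvaginPrime (W.conductorNorm ℤ) W K p ℓ →
            k ≤ Zhang2014.kolyvaginIndex W p ℓ → ℓ ∉ c.1.primeFactors →
            ∀ (v : HeightOneSpectrum (𝓞 K)), (ℓ : 𝓞 K) ∈ v.asIdeal →
            ∃ (Sg : Type) (_ : AddCommGroup Sg)
            (sing : signPart W K τ ((p ^ k : ℕ) : ℤ) (-e')
            (((selmerF0 W ((p ^ k : ℕ) : ℤ) 𝒯 𝒮 (placesDividing K c.1) Qcar).relaxedAt {v}).selmerGroup) →+ Sg),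
            (∀ x, sing x = 0 ↔ (x : galoisCohomology ((W.baseChange K).torsionGaloisModule ((p ^ k : ℕ) : ℤ)) 1) ∈
            signPart W K τ ((p ^ k : ℕ) : ℤ) (-e')
            ((selmerF0 W ((p ^ k : ℕ) : ℤ) 𝒯 𝒮 (placesDividing K c.1) Qcar).selmerGroup)) ∧
            Nat.card sing.range *
            Nat.card (C'.map (galoisCohomology.localization
            ((W.baseChange K).torsionGaloisModule ((p ^ k : ℕ) : ℤ)) (Sum.inr v) 1 :
            galH1Torsion (W.baseChange K) ((p ^ k : ℕ) : ℤ) →+ _)) = p ^ k))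

/-- Statement of `stub_publishedInputsHeegner` (cite): the route's HELD conjunction `PublishedInputsHeegner`
(item 19914) BY NAME — byte-identical to v1. -/
abbrev Sig.stub_publishedInputsHeegner : Prop := PublishedInputsHeegner

theorem stub_structureIrred : Sig.stub_structureIrred := by
  sorry

theorem stub_prop52IrredP : Sig.stub_prop52IrredP := by
  sorry

theorem stub_coreVertexExistenceIrredP : Sig.stub_coreVertexExistenceIrredP := by
  sorry

theorem stub_prop44Irred : Sig.stub_prop44Irred := by
  sorry

theorem stub_thm52KernelGapsAddv : Sig.stub_thm52KernelGapsAddv := by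
  sorry

theorem stub_publishedInputsHeegner : Sig.stub_publishedInputsHeegner := by
  sorry

/-- **v2's hardest stub is PROVED from the two remaining readings/gaps** (k8t-c4 g8's kernel cut p508713 as re-issued
Čebotarev-free by k8t-c4 g9: the reading h32I is now the THEOREM `cor32_localOrder_of_irreducible_of_heegner`): supply the
row's named print, sign, GZ integer, structures and gaps from `stub_thm52KernelGapsAddv`, `p ∣ N` from `Addv`, `t := ord_p c_q`,
and call `tamagawaExponent_le_mInfty_of_kernelInputs_of_irreducible_of_heegner`. A REAL proof.
[cite: Jetchev2008, Thm. 5.2 (p. 821) and proof] -/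
theorem H63IRowObjectsAddv_of (h44 : Sig.stub_prop44Irred)
    (hKG : Sig.stub_thm52KernelGapsAddv) : Sig.H63IRowObjectsAddv := by
  intro W _ _ _ hcm K _ _ hK hD3 hD4 hH τ hτ p _ hp2 hadd hj hirr hcp htam Dt β ι _ d₁ hd₁ q _ hq hq2 hqp
    mdiv m hmdiv hm mInf hmin hwit k c hk hcore hmc hkM htk hik
  obtain ⟨hCM1, hCM2, ε, hε, h53, n', hcop', hGZ, 𝒯, 𝒮, Qcar, e', C', hT, hS, hQcar, he', hC, htr, hdual_q,
      h49str, h49tr, hdual_ℓ⟩ :=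
    hKG W hcm K hK hD3 hD4 hH τ hτ p hp2 hadd hj hirr hcp htam Dt β ι d₁ hd₁ q hq hq2 hqp
      mdiv m hmdiv hm mInf hmin hwit k c hk hcore hmc hkM htk hik
  exact JetchevIrreducibleReadingThm52.tamagawaExponent_le_mInfty_of_kernelInputs_of_irreducible_of_heegner h44 W hcm
    K hK hD3 hD4 hH hCM1 hCM2 p hp2 hirr ((W.dvd_conductorNorm_iff_not_hasGoodReductionAtPrime p).mpr hadd.1)
    Dt β ι τ hτ ε hε h53 hcop' hGZ mdiv m hmdiv hm k c hk hcore mInf hmc hkM _ htk hik 𝒯 𝒮 hT hS Qcar hQcar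
    e' he' C' hC htr hdual_q h49str h49tr hdual_ℓ

/-- **S2 of v1 is now PROVED from the three new stubs** (g8's kernel cut p504855, with `hRCF` discharged by
`JET.numberField_ringClassField`): the body of v1's `Sig.stub_divisibilityIrredAddv`, renamed
`Sig.S2DivisibilityIrredAddv` (no longer a stub). [cite: Jetchev2008, Thm. 1.4 (ii), Prop. 5.3, Thm. 5.2] -/
theorem S2DivisibilityIrredAddv_of (h52 : Sig.stub_prop52IrredP) (hCV : Sig.stub_coreVertexExistenceIrredP)
    (h63 : Sig.H63IRowObjectsAddv) : Sig.S2DivisibilityIrredAddv :=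
  JetchevIrreducibleReadingDivisibilityPrimed.divisibilityIrredAddv_of_prop52IrredP_of_coreVertexExistenceIrredP_of_thm63
    h52 hCV
    (fun K _ _ ι hK k ↦ Summit.BirchSwinnertonDyer.Rank1Residual.JET.numberField_ringClassField K hK ι k) h63

/-- **The crux from the six stubs (K8-t′ decl)** — g8's capstone p502280 fed with S1, the proved S2 and PIH.
A REAL proof; sorries only inside the stubs. [cite: Jetchev2008, Cor. 1.5 (p. 812)] [cite: MatarNekovar2019, Thm. 0.7, §0.11] -/
theorem JetchevIrreducibleReadingByName_of (hS : Sig.stub_structureIrred) (h52 : Sig.stub_prop52IrredP)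
    (hCV : Sig.stub_coreVertexExistenceIrredP) (h44 : Sig.stub_prop44Irred)
    (hKG : Sig.stub_thm52KernelGapsAddv) (hH : Sig.stub_publishedInputsHeegner) :
    Summit.BirchSwinnertonDyer.BirchSwinnertonDyer.Theses.KatoDescentTamePotSupersingular.JetchevIrreducibleReadingByName :=
  JetchevIrreducibleReadingOfStubs.jetchevIrreducibleReadingByName_of_structureIrred_of_divisibilityIrred_of_publishedInputsHeegner
    hS (S2DivisibilityIrredAddv_of h52 hCV (H63IRowObjectsAddv_of h44 hKG)) hH

/-- **The K9 face (shared signature)** — g8's twin capstone p502729. -/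
theorem JetchevIrreducibleReadingByName_of_K9 (hS : Sig.stub_structureIrred) (h52 : Sig.stub_prop52IrredP)
    (hCV : Sig.stub_coreVertexExistenceIrredP) (h44 : Sig.stub_prop44Irred)
    (hKG : Sig.stub_thm52KernelGapsAddv) (hH : Sig.stub_publishedInputsHeegner) :
    Summit.BirchSwinnertonDyer.BirchSwinnertonDyer.Theses.KatoDescentPotSupersingular.JetchevIrreducibleReadingByName :=
  WildJetchevIrreducibleReadingOfStubs.jetchevIrreducibleReadingByName_of_structureIrred_of_divisibilityIrred_of_publishedInputsHeegner
    hS (S2DivisibilityIrredAddv_of h52 hCV (H63IRowObjectsAddv_of h44 hKG)) hH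

/-- Sanity composition with the sorried stubs (what a sorry-free skeleton would deliver). -/
theorem jetchevIrreducibleReadingByName_of_stubs :
    Summit.BirchSwinnertonDyer.BirchSwinnertonDyer.Theses.KatoDescentTamePotSupersingular.JetchevIrreducibleReadingByName :=
  JetchevIrreducibleReadingByName_of stub_structureIrred stub_prop52IrredP stub_coreVertexExistenceIrredP
    stub_prop44Irred stub_thm52KernelGapsAddv stub_publishedInputsHeegner

end Summit.BirchSwinnertonDyer.BirchSwinnertonDyer.Cruxes.JetchevIrreducibleReadingByName.BirthV5

end
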